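/-
Copyright (c) 2026 the pub-hodgecm-mathlib formalisation cell (harness21).  Prover seat hodgecm-mathlib-LH4-p02 (g12): STAGE 1a «(D-RAM) FOUR-FRAME» squad of
crux H413 (director s1808; heir LEAD F0P3a-plan (g18); dealer LH4-plan (g10) WORD #11; U0 assembler LH4-p01 (g17) — tier 2 for `stub_U0_valency_typeZero_wild`), 2026-09-03.
§1–§2 are ADAPTED from ★ `UnitaryLatticeTreeRootStarOrbitOfInvolution` §3–§4 and ★ `UnitaryLatticeTreeRootStarCountOfInvolution` §2 (both F0P3a-p07 (g11), themselves adapted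
from ★ B-p14 (g36)), with the trace-one element replaced by ★ LH4-p01 (g17)'s wild root-star transitivity (`UnitaryLatticeTreeRootStarOrbitWild`, p854659).
-/
import Literature.NumberTheory.Automorphic.UnitaryLatticeTreeRootStarCountOfInvolution    -- ★ (F0P3a-p07 (g11)): the tame bijection `natCard_neighborSet_root_eq_of_trace`, `natCard_conicParams_eq`, `ncard_neighborSet_root_of_ramified`; brings ★ V2b helpers
import Literature.NumberTheory.Automorphic.UnitaryLatticeTreeRootStarOrbitWild            -- ★ p854659 (LH4-p01 (g17)): `exists_mem_unitaryInt_rootStar_eq_of_ramified`, `exists_mem_unitaryInt_eq_mapGL_N₁_of_lt_of_ramified`; brings ★ p854568 `…SelfDualTransitiveWild`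
import Literature.NumberTheory.Automorphic.UnitaryLatticeTreeTypeTwoStarCountWild          -- ★ p854683 (this seat): `isVertexLattice_two_N₁_of_uniformizer`; brings ★ `…ResiduallyUnipotentCorner` residue lemmas
import HarnessLib

/-!
# The lattice graph of a hermitian space — `q + 1` NEIGHBOURS AT EVERY SELF-DUAL VERTEX OF THE `U(3)` TREE AT ANY RAMIFIED PLACE, WILD DYADIC ONES INCLUDED
# (Tits 1979 §2.4 ∕ §2.7; Bruhat–Tits 1972 (4.4.4), §10; Serre, *Trees* II.1.1)

Topic `NumberTheory/Automorphic`; namespace `Literature.NumberTheory.Automorphic.UnitaryLatticeTree`.  THEOREMS ONLY (no definition, no instance, no notation, no named fact,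
no `sorry`); kernel lane.  Cell `pub/hodgecm-mathlib` (D-0151), crux H413 = `stmt-HodgeConjecture-24833`; road «(D-RAM) FOUR-FRAME» (STAGE 1a), unit U0_WildTree of the sibling
line `Cruxes/H413/Lines/F0_P3c_DyRamFourFrame.lean`, row `stub_U0_valency_typeZero_wild` (module `…F0_P3c_DyRamFourFrame_U0_WildTree`): `#star(v) = q + 1` at every SELF-DUAL
vertex for EVERY ramified datum `IsRamifiedQuadraticDatum σ ϖ d t` (tame, ramified-prime, ramified-unit).  ★ `…RootStarCountOfInvolution` proves the bijection
`star(L₀) ≃ Option {(ā,b̄) | b̄ + σk b̄ + ā σk ā = 0}` from an INTEGRAL TRACE-ONE element (absent at `d ≥ 2`) and counts the affine conic `2b̄ + ā² = 0` at `|2| = 1`.  HERE: (§1–§2)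
the same bijection with the trace element replaced by ★ LH4-p01 (g17)'s wild root-star transitivity `exists_mem_unitaryInt_rootStar_eq_of_ramified` (exact isotropic lifts by
«trace + norm» at the datum) — proofs otherwise verbatim, credited; (§3) at a WILD place (`|2| < 1`, so `2 = 0` in `𝓀`) the parameter set is the DOUBLE LINE `{ā² = 0} = {0} × 𝓀`
— still `q` points — and at a tame place the ★ conic; (§4) `#star(L₀) = q + 1` at every datum, transport to every self-dual vertex by ★ htr₀-wild (p854568), and the DATUM-FORM
head in the exact shape of the module's stub.
HONEST LABEL: HC_CM is proved only modulo the 7 printed citations (2 remaining: hLiu418 = stmt-HodgeConjecture-24832, h413 = stmt-HodgeConjecture-24833) until rung 0 closes; nothing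
printed is asserted here; (D-RAM) `stub_DyRamCore` stays PRINT until the road's END lands.

* §1 `mem_neighborSet_root_iff_exists_mem_unitaryInt_of_even`, `exists_mem_neighborSet_root_forall_mem_iff_of_even`, `exists_isotropic_forall_mem_iff_of_mem_neighborSet_root_of_even`.
* §2 **`natCard_neighborSet_root_eq_of_even`**.  §3 `natCard_doubleLineParams_eq` (`2 = 0` in `k`).  §4 **`ncard_neighborSet_root_wild`**, **`ncard_neighborSet_of_isSelfDualLattice_wild`**,
  **`ncard_neighborSet_of_isSelfDualLattice_of_isRamifiedQuadraticDatum`** (U0's stub shape).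

## References
* [Tits1979] J. Tits, *Reductive groups over local fields*, PSPM 33.1 (1979), §2.4, §2.7 (ramified quasi-split `U(3)`: local index `(q+1, q+1)`), §3.5.
* [BruhatTits1972] F. Bruhat, J. Tits, *Groupes réductifs sur un corps local I*, Publ. Math. IHÉS 41 (1972), (4.4.4), §10.  [Serre1980Trees] J.-P. Serre, *Trees* (1980), Ch. II §1.1.
* [Jacobowitz1962] R. Jacobowitz, *Hermitian forms over local fields*, Amer. J. Math. 84 (1962), §§9–11.
-/

set_option autoImplicit false

noncomputable section

open scoped Valued WithZero Matrix MatrixGroups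

namespace Literature.NumberTheory.Automorphic.UnitaryLatticeTree

open Literature.NumberTheory.Automorphic Literature.NumberTheory.Automorphic.HermitianLattice Literature.NumberTheory.Automorphic.CartanUnique
open Literature.NumberTheory.Automorphic.UnitaryThreeFourFrame

variable {K : Type*} [Field K] [Valued K ℤᵐ⁰] {σ : K →+* K} {ϖ : K}

/-! ## §1 The star of the root at a ramified datum: `K₀`-orbit of `N₁` and residual hyperplanes (★ R2a §3–§4 with the wild root-star transitivity) -/

/-- **`star(L₀) = {κ·N₁ | κ ∈ K₀}`**: a vertex is adjacent to the root `𝒪³` iff it is a `K₀`-translate of the standard type-two neighbour `N₁ = latt diag(1,1,ϖ)`.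
[cite: BruhatTits1972, (4.4.4) and §10] [cite: Tits1979, §3.5] [cite: Serre1980Trees, II.1.1] -/
theorem mem_neighborSet_root_iff_exists_mem_unitaryInt_of_even [Finite 𝓀[K]] (hσ : ∀ x, σ (σ x) = x) (hvσ : ∀ a, Valued.v (σ a) = Valued.v a) (hϖ : Valued.v ϖ = WithZero.exp (-1 : ℤ)) (heven : ∀ x : K, σ x = x → x ≠ 0 → ∃ n : ℤ, Valued.v x = WithZero.exp (2 * n)) {d t : ℕ}
    (hd : Valued.v (ϖ - σ ϖ) = Valued.v ϖ ^ d) (h1d : 1 ≤ d) (h2t : Valued.v (2 : K) = Valued.v ϖ ^ t)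
    (w : {M : Submodule 𝒪[K] (Fin 3 → K) // IsVertex σ ϖ ((StdForm.antidiagonal 3).over K) M}) :
    w ∈ (latticeGraph σ ϖ ((StdForm.antidiagonal 3).over K)).neighborSet ⟨stdLattice K 3, 0, isSelfDualLattice_stdLattice_three_of_v hϖ⟩ ↔
      ∃ κ : unitaryGroupOfForm σ ((StdForm.antidiagonal 3).over K), κ ∈ unitaryInt σ ((StdForm.antidiagonal 3).over K) ∧
        w.1 = mapGL (κ : GL (Fin 3) K) (latt (Matrix.diagonal ![(1 : K), 1, ϖ])) := by
  rw [mem_neighborSet_root_iff_of_v hvσ hϖ]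
  constructor
  · intro hlt
    have h2 : IsVertexLattice σ ϖ ((StdForm.antidiagonal 3).over K) 2 w.1 :=
      (isVertexLattice_two_and_isSelfDualLattice_of_lt_of_v hvσ hϖ w.2 ⟨0, isSelfDualLattice_stdLattice_three_of_v hϖ⟩ hlt).1
    exact exists_mem_unitaryInt_eq_mapGL_N₁_of_lt_of_ramified hσ hvσ hϖ heven hd h1d h2t h2 hlt
  · rintro ⟨κ, hκ, hw⟩
    rw [hw]
    exact mapGL_N₁_lt_stdLattice_of_v hvσ hϖ (isVertexLattice_two_N₁_of_uniformizer hvσ hϖ) hκ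

/-- **Every primitive residually isotropic `x ∈ 𝒪³` cuts out a vertex of the star of the root**: there is `w ∈ star(L₀)` whose lattice is
`N_x = {y ∈ 𝒪³ | B₀ x y ∈ 𝔪}` (namely `κ·N₁` for the `κ ∈ K₀` of ★ `exists_mem_unitaryInt_rootStar_eq`). [cite: BruhatTits1972, (4.4.4) and §10] [cite: Serre1980Trees, II.1.1] -/
theorem exists_mem_neighborSet_root_forall_mem_iff_of_even [Finite 𝓀[K]] (hσ : ∀ x, σ (σ x) = x) (hvσ : ∀ a, Valued.v (σ a) = Valued.v a) (hϖ : Valued.v ϖ = WithZero.exp (-1 : ℤ)) (heven : ∀ x : K, σ x = x → x ≠ 0 → ∃ n : ℤ, Valued.v x = WithZero.exp (2 * n)) {d t : ℕ}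
    (hd : Valued.v (ϖ - σ ϖ) = Valued.v ϖ ^ d) (h1d : 1 ≤ d) (h2t : Valued.v (2 : K) = Valued.v ϖ ^ t) {x : Fin 3 → K} (hx : x ∈ stdLattice K 3)
    (hunit : ∃ j, Valued.v (x j) = 1) (hiso : Valued.v (B₀ σ 3 x x) < 1) :
    ∃ w ∈ (latticeGraph σ ϖ ((StdForm.antidiagonal 3).over K)).neighborSet ⟨stdLattice K 3, 0, isSelfDualLattice_stdLattice_three_of_v hϖ⟩,
      ∀ y, y ∈ w.1 ↔ y ∈ stdLattice K 3 ∧ Valued.v (B₀ σ 3 x y) < 1 := by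
  have hϖ0 : ϖ ≠ 0 := uniformizer_ne_zero hϖ
  have hϖ1 : Valued.v ϖ ≤ 1 := uniformizer_mem_integer hϖ
  obtain ⟨κ, hκ, hiff⟩ := exists_mem_unitaryInt_rootStar_eq_of_ramified hσ hvσ hϖ heven hd h1d h2t hx hunit hiso
  have r0 : Fin.rev (0 : Fin 3) = 2 := by decide
  simp only [r0] at hiff
  refine ⟨⟨mapGL (κ : GL (Fin 3) K) (latt (Matrix.diagonal ![(1 : K), 1, ϖ])), 2,
    isVertexLattice_mapGL σ ϖ _ _ κ.2 (isVertexLattice_two_N₁_of_uniformizer hvσ hϖ)⟩,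
    (mem_neighborSet_root_iff_exists_mem_unitaryInt_of_even hσ hvσ hϖ heven hd h1d h2t _).2 ⟨κ, hκ, rfl⟩, fun y => ?_⟩
  rw [mem_mapGL_N₁_iff_of_mem_unitaryInt hϖ hκ y]
  constructor
  · rintro ⟨hyL, h2⟩; exact ⟨hyL, (hiff y hyL).2 h2⟩
  · rintro ⟨hyL, hB⟩; exact ⟨hyL, (hiff y hyL).1 hB⟩
/-- **Every vertex of the star of the root is a residual hyperplane `N_x`** with `x ∈ 𝒪³` primitive and EXACTLY isotropic (`x = κe₀` for the `κ ∈ K₀` of §3, ★ `firstColumn_props`,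
★ `mem_mapGL_N₁_iff`). [cite: BruhatTits1972, §10] [cite: Tits1979, §3.5] [cite: Serre1980Trees, II.1.1] -/
theorem exists_isotropic_forall_mem_iff_of_mem_neighborSet_root_of_even [Finite 𝓀[K]] (hσ : ∀ x, σ (σ x) = x) (hvσ : ∀ a, Valued.v (σ a) = Valued.v a) (hϖ : Valued.v ϖ = WithZero.exp (-1 : ℤ)) (heven : ∀ x : K, σ x = x → x ≠ 0 → ∃ n : ℤ, Valued.v x = WithZero.exp (2 * n)) {d t : ℕ}
    (hd : Valued.v (ϖ - σ ϖ) = Valued.v ϖ ^ d) (h1d : 1 ≤ d) (h2t : Valued.v (2 : K) = Valued.v ϖ ^ t)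
    {w : {M : Submodule 𝒪[K] (Fin 3 → K) // IsVertex σ ϖ ((StdForm.antidiagonal 3).over K) M}}
    (hw : w ∈ (latticeGraph σ ϖ ((StdForm.antidiagonal 3).over K)).neighborSet ⟨stdLattice K 3, 0, isSelfDualLattice_stdLattice_three_of_v hϖ⟩) :
    ∃ x : Fin 3 → K, x ∈ stdLattice K 3 ∧ (∃ j, Valued.v (x j) = 1) ∧ B₀ σ 3 x x = 0 ∧
      ∀ y, y ∈ w.1 ↔ y ∈ stdLattice K 3 ∧ Valued.v (B₀ σ 3 x y) < 1 := by
  have hϖ0 : ϖ ≠ 0 := uniformizer_ne_zero hϖ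
  have hϖ1 : Valued.v ϖ ≤ 1 := uniformizer_mem_integer hϖ
  have hlt1 : ∀ z : K, Valued.v z < 1 ↔ Valued.v z ≤ Valued.v ϖ := fun z => by rw [hϖ]; exact v_lt_one_iff z
  obtain ⟨κ, hκ, hwκ⟩ := (mem_neighborSet_root_iff_exists_mem_unitaryInt_of_even hσ hvσ hϖ heven hd h1d h2t w).1 hw
  obtain ⟨hxint, hxiso, hxunit⟩ := firstColumn_props (K := K) hκ
  refine ⟨_, hxint, hxunit, hxiso, fun y => ?_⟩
  rw [hwκ]
  constructor
  · intro hy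
    have hyL : y ∈ stdLattice K 3 := (mapGL_N₁_le hκ hϖ1 hϖ0).2 hy
    exact ⟨hyL, (hlt1 _).2 ((mem_mapGL_N₁_iff hκ hϖ0 hyL).1 hy)⟩
  · rintro ⟨hyL, hB⟩
    exact (mem_mapGL_N₁_iff hκ hϖ0 hyL).2 ((hlt1 _).1 hB)

/-! ## §2 The bijection with the normalised residual parameters (★ V2b∕R2b §2, trace element replaced) -/

/-- **THE STAR OF THE ROOT ↔ THE ISOTROPIC POINTS OF `(𝓀³, B̄₀)`, NORMALISED**: `#star(L₀) = #(Option {(ā, b̄) ∈ 𝓀² | b̄ + σk b̄ + ā σk ā = 0})` — the point at infinity `[0:0:1]`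
(the neighbour `N_{e₂}`) and the affine isotropic points `[1:ā:b̄]` (the neighbours `N_{(1,A,B)}`).  At ANY ramified place of the datum (wild ones included: the trace-one element of ★ `…_of_trace` is replaced by ★ LH4-p01 (g17) `exists_mem_unitaryInt_rootStar_eq_of_ramified`); valid for any reduction `σk` of `σ`.
[cite: BruhatTits1972, §10] [cite: Tits1979, §3.5] [cite: Serre1980Trees, II.1.1] -/
theorem natCard_neighborSet_root_eq_of_even [Finite 𝓀[K]] (hσ : ∀ x, σ (σ x) = x) (hvσ : ∀ a, Valued.v (σ a) = Valued.v a) (hϖ : Valued.v ϖ = WithZero.exp (-1 : ℤ)) (heven : ∀ x : K, σ x = x → x ≠ 0 → ∃ n : ℤ, Valued.v x = WithZero.exp (2 * n)) {d t : ℕ}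
    (hd : Valued.v (ϖ - σ ϖ) = Valued.v ϖ ^ d) (h1d : 1 ≤ d) (h2t : Valued.v (2 : K) = Valued.v ϖ ^ t) (hσO : ∀ x : 𝒪[K], σ x ∈ 𝒪[K]) (σk : 𝓀[K] →+* 𝓀[K])
    (hσk : ∀ x : 𝒪[K], IsLocalRing.residue 𝒪[K] ⟨σ x, hσO x⟩ = σk (IsLocalRing.residue 𝒪[K] x)) :
    Nat.card ((latticeGraph σ ϖ ((StdForm.antidiagonal 3).over K)).neighborSet ⟨stdLattice K 3, 0, isSelfDualLattice_stdLattice_three_of_v hϖ⟩) =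
      Nat.card (Option {p : 𝓀[K] × 𝓀[K] // p.2 + σk p.2 + p.1 * σk p.1 = 0}) := by
  classical
  -- a section of the residue map and the normalised vectors
  obtain ⟨lift, hlift⟩ : ∃ lift : 𝓀[K] → 𝒪[K], ∀ a, IsLocalRing.residue 𝒪[K] (lift a) = a :=
    ⟨Function.surjInv IsLocalRing.residue_surjective, Function.surjInv_eq IsLocalRing.residue_surjective⟩
  let xOf : Option {p : 𝓀[K] × 𝓀[K] // p.2 + σk p.2 + p.1 * σk p.1 = 0} → (Fin 3 → K) := fun p =>
    p.elim (Pi.single 2 1) fun q => ![(1 : K), (lift q.1.1 : K), (lift q.1.2 : K)]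
  have hxOf_none : xOf none = Pi.single 2 1 := rfl
  have hxOf_some : ∀ q, xOf (some q) = ![(1 : K), (lift q.1.1 : K), (lift q.1.2 : K)] := fun _ => rfl
  have hxL : ∀ p, xOf p ∈ stdLattice K 3 := by
    rintro (_ | q)
    · rw [hxOf_none]; exact single_mem_stdLattice 2
    · rw [hxOf_some]; exact vec_mem_stdLattice _ _
  have hxu : ∀ p, ∃ j, Valued.v (xOf p j) = 1 := by
    rintro (_ | q)
    · exact ⟨2, by rw [hxOf_none]; simp⟩
    · exact ⟨0, by rw [hxOf_some]; simp⟩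
  have hxiso : ∀ p, Valued.v (B₀ σ 3 (xOf p) (xOf p)) < 1 := by
    rintro (_ | q)
    · rw [hxOf_none, B₀_single_left, show Fin.rev (2 : Fin 3) = 0 from rfl]; simp
    · rw [hxOf_some]
      refine v_B₀_vec_self_lt_one hσO σk hσk ?_
      rw [hlift, hlift]; exact q.2
  -- the vertices `N_{x_p}`
  choose f hf using fun p => exists_mem_neighborSet_root_forall_mem_iff_of_even hσ hvσ hϖ heven hd h1d h2t (hxL p) (hxu p) (hxiso p)
  -- hyperplane membership of `𝒪³`-vectors, read off `f`
  have hfiff : ∀ p, ∀ y ∈ stdLattice K 3, (y ∈ (f p).1 ↔ Valued.v (B₀ σ 3 (xOf p) y) < 1) := fun p y hy => by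
    rw [(hf p).2 y]; exact ⟨fun h => h.2, fun h => ⟨hy, h⟩⟩
  refine (Nat.card_congr (Equiv.ofBijective (fun p => (⟨f p, (hf p).1⟩ :
    (latticeGraph σ ϖ ((StdForm.antidiagonal 3).over K)).neighborSet ⟨stdLattice K 3, 0, isSelfDualLattice_stdLattice_three_of_v hϖ⟩)) ⟨?_, ?_⟩)).symm
  · -- injective: equal hyperplanes ⇒ equal normalised parameters
    intro p p' hpp'
    have hEq : f p = f p' := congrArg Subtype.val hpp'
    have hiff : ∀ y ∈ stdLattice K 3, (Valued.v (B₀ σ 3 (xOf p) y) < 1 ↔ Valued.v (B₀ σ 3 (xOf p') y) < 1) := fun y hy => by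
      rw [← hfiff p y hy, ← hfiff p' y hy, hEq]
    rcases p with _ | ⟨⟨a, b⟩, hab⟩ <;> rcases p' with _ | ⟨⟨a', b'⟩, hab'⟩
    · rfl
    · exact absurd hiff (by rw [hxOf_none, hxOf_some]; exact not_forall_v_B₀_single_iff_vec hvσ _ _)
    · refine absurd (fun y hy => (hiff y hy).symm) ?_
      rw [hxOf_none, hxOf_some]; exact not_forall_v_B₀_single_iff_vec hvσ _ _
    · rw [hxOf_some, hxOf_some] at hiff
      obtain ⟨ha, hb⟩ := residue_eq_of_forall_v_B₀_vec_iff hvσ hiff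
      simp only [hlift] at ha hb
      subst ha hb
      rfl
  · -- surjective: every vertex of the star is the hyperplane of a normalised vector
    rintro ⟨w, hw⟩
    obtain ⟨x, hx, hunit, hiso, hmem⟩ := exists_isotropic_forall_mem_iff_of_mem_neighborSet_root_of_even hσ hvσ hϖ heven hd h1d h2t hw
    have key : ∀ p, (∃ c : K, Valued.v c = 1 ∧ ∀ i, Valued.v (x i - c * xOf p i) < 1) → f p = w := fun p hc => by
      refine eq_of_forall_mem_iff fun y => ?_
      rw [(hf p).2 y, hmem y]
      exact and_congr_right fun hy => (forall_v_B₀_lt_one_iff_of_exists_unit_congr hvσ hc y hy).symm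
    rcases exists_unit_congr_normalForm_of_isotropic_of_v hvσ hσO σk hσk lift hlift hx hunit hiso with hc | ⟨p, hc⟩
    · exact ⟨none, Subtype.ext (key none (by rw [hxOf_none]; exact hc))⟩
    · exact ⟨some p, Subtype.ext (key (some p) (by rw [hxOf_some]; exact hc))⟩

/-! ## §3 The residual parameter set at a WILD place: the double line `ā² = 0` -/

/-- **Over a field with `2 = 0` the affine «conic» `b + b + a·a = 0` is the DOUBLE LINE `a = 0`, with exactly `|k|` points** (`(0, b)`, `b ∈ k`; `a·a = −2b = 0` forces `a = 0`).
The wild-dyadic counterpart of ★ `natCard_conicParams_eq` (`2 ≠ 0`: the conic `b = −a²∕2`). [cite: Tits1979, §2.7] -/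
theorem natCard_doubleLineParams_eq {k : Type*} [Field k] (h2 : (2 : k) = 0) :
    Nat.card {p : k × k // p.2 + (RingHom.id k) p.2 + p.1 * (RingHom.id k) p.1 = 0} = Nat.card k := by
  refine Nat.card_congr
    { toFun := fun p => p.1.2
      invFun := fun b => ⟨(0, b), by simp only [RingHom.id_apply, mul_zero, add_zero]; rw [← two_mul, h2, zero_mul]⟩
      left_inv := fun p => ?_
      right_inv := fun b => rfl }
  obtain ⟨⟨a, b⟩, hab⟩ := p
  simp only [RingHom.id_apply] at hab
  have ha : a = 0 := by
    have h : a * a = 0 := by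
      have h' : a * a = -(b + b) := by linear_combination hab
      rw [h', ← two_mul, h2, zero_mul, neg_zero]
    exact mul_self_eq_zero.1 h
  subst ha
  rfl

/-! ## §4 The counts: `q + 1` neighbours at every self-dual vertex, every ramified datum -/

/-- **THE STAR OF THE ROOT HAS `q + 1` VERTICES AT EVERY RAMIFIED DATUM** (`q = |𝓀[K]|`): at a TAME place (`|2| = 1`) ★ `ncard_neighborSet_root_of_ramified` (the residual conic);
at a WILD place (`|2| < 1`, so `2 = 0` in `𝓀` and `σ` acts trivially on `𝓀` by ★ `v_map_sub_self_lt_one_of_even`) §2 + §3 (the double line). [cite: Tits1979, §2.4, §2.7] [cite: BruhatTits1972, §10] -/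
theorem ncard_neighborSet_root_wild [Finite 𝓀[K]] (hσ : ∀ x, σ (σ x) = x) (hvσ : ∀ a, Valued.v (σ a) = Valued.v a) (hϖ : Valued.v ϖ = WithZero.exp (-1 : ℤ))
    (heven : ∀ x : K, σ x = x → x ≠ 0 → ∃ n : ℤ, Valued.v x = WithZero.exp (2 * n)) {d t : ℕ}
    (hd : Valued.v (ϖ - σ ϖ) = Valued.v ϖ ^ d) (h1d : 1 ≤ d) (h2t : Valued.v (2 : K) = Valued.v ϖ ^ t) :
    ((latticeGraph σ ϖ ((StdForm.antidiagonal 3).over K)).neighborSet ⟨stdLattice K 3, 0, isSelfDualLattice_stdLattice_three_of_v hϖ⟩).ncard = Nat.card 𝓀[K] + 1 := by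
  have hres : ∀ x : K, Valued.v x ≤ 1 → Valued.v (σ x - x) < 1 := fun x hx => v_map_sub_self_lt_one_of_even hσ hϖ heven hd h1d hx
  by_cases h2 : Valued.v (2 : K) = 1
  · exact ncard_neighborSet_root_of_ramified hσ hvσ hϖ hres h2 (isVertexLattice_two_N₁_of_uniformizer hvσ hϖ)
  · have hv2 : Valued.v (2 : K) ≤ 1 := by
      rw [show (2 : K) = 1 + 1 by norm_num]; exact (Valuation.map_add _ _ _).trans (by rw [map_one, max_self])
    have h2lt : Valued.v (2 : K) < 1 := lt_of_le_of_ne hv2 h2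
    have hσO : ∀ x : 𝒪[K], σ x ∈ 𝒪[K] := fun x => by change Valued.v (σ x) ≤ 1; rw [hvσ]; exact x.2
    have hσk : ∀ x : 𝒪[K], IsLocalRing.residue 𝒪[K] ⟨σ x, hσO x⟩ = (RingHom.id 𝓀[K]) (IsLocalRing.residue 𝒪[K] x) := fun x =>
      residue_eq_of_v_sub_lt_one (hres x x.2)
    have h2k : (2 : 𝓀[K]) = 0 := by
      rw [show (2 : 𝓀[K]) = IsLocalRing.residue 𝒪[K] 2 from (map_ofNat _ 2).symm, residue_eq_zero_iff_v_lt_one]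
      exact h2lt
    rw [← Nat.card_coe_set_eq, natCard_neighborSet_root_eq_of_even hσ hvσ hϖ heven hd h1d h2t hσO (RingHom.id _) hσk, Finite.card_option,
      natCard_doubleLineParams_eq h2k]

/-- **EVERY SELF-DUAL VERTEX OF THE `U(3)` TREE HAS EXACTLY `q + 1` NEIGHBOURS AT ANY RAMIFIED PLACE, WILD ONES INCLUDED** — transport from the root by ★ htr₀-wild
`exists_unitary_mapGL_stdLattice_eq_of_isSelfDualLattice_of_ramified` (LH4-p01 (g17)) through the graph automorphism `latticeGraphIso`. [cite: Tits1979, §2.4, §2.7] [cite: BruhatTits1972, §10] [cite: Serre1980Trees, II.1.1] -/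
theorem ncard_neighborSet_of_isSelfDualLattice_wild [Finite 𝓀[K]] (hσ : ∀ x, σ (σ x) = x) (hvσ : ∀ a, Valued.v (σ a) = Valued.v a) (hϖ : Valued.v ϖ = WithZero.exp (-1 : ℤ))
    (heven : ∀ x : K, σ x = x → x ≠ 0 → ∃ n : ℤ, Valued.v x = WithZero.exp (2 * n)) {d t : ℕ}
    (hd : Valued.v (ϖ - σ ϖ) = Valued.v ϖ ^ d) (h1d : 1 ≤ d) (h2t : Valued.v (2 : K) = Valued.v ϖ ^ t)
    (v : {M : Submodule 𝒪[K] (Fin 3 → K) // IsVertex σ ϖ ((StdForm.antidiagonal 3).over K) M}) (hv : IsSelfDualLattice σ ϖ ((StdForm.antidiagonal 3).over K) v.1) :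
    ((latticeGraph σ ϖ ((StdForm.antidiagonal 3).over K)).neighborSet v).ncard = Nat.card 𝓀[K] + 1 := by
  obtain ⟨u, hu⟩ := exists_unitary_mapGL_stdLattice_eq_of_isSelfDualLattice_of_ramified hσ hvσ hϖ heven hd h1d h2t v.1 hv
  have hv' : latticeGraphIso σ ϖ ((StdForm.antidiagonal 3).over K) u ⟨stdLattice K 3, 0, isSelfDualLattice_stdLattice_three_of_v hϖ⟩ = v :=
    Subtype.ext (by rw [latticeGraphIso_apply_val]; exact hu.symm)
  rw [← hv', ncard_neighborSet_latticeGraphIso u _]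
  exact ncard_neighborSet_root_wild hσ hvσ hϖ heven hd h1d h2t

/-- **THE DATUM-FORM HEAD (the shape of U0's `stub_U0_valency_typeZero_wild`)**: for every `IsRamifiedQuadraticDatum σ ϖ d t` with finite residue field and every self-dual
(type-`0`) vertex `v`, `#star(v) = |𝓀[K]| + 1`. [cite: Tits1979, §2.4, §2.7] [cite: BruhatTits1972, §10] -/
theorem ncard_neighborSet_of_isSelfDualLattice_of_isRamifiedQuadraticDatum {K : Type} [Field K] [Valued K ℤᵐ⁰] [Finite 𝓀[K]] (σ : K →+* K) (ϖ : K) (d t : ℕ)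
    (hD : IsRamifiedQuadraticDatum σ ϖ d t) (v : {M : Submodule 𝒪[K] (Fin 3 → K) // IsVertex σ ϖ ((StdForm.antidiagonal 3).over K) M})
    (hv : IsVertexLattice σ ϖ ((StdForm.antidiagonal 3).over K) 0 v.1) :
    ((latticeGraph σ ϖ ((StdForm.antidiagonal 3).over K)).neighborSet v).ncard = Nat.card 𝓀[K] + 1 := by
  obtain ⟨hσ, hvσ, hϖ, heven, hd, h1d, h2t⟩ := hD
  exact ncard_neighborSet_of_isSelfDualLattice_wild hσ hvσ hϖ heven hd h1d h2t v hv

end Literature.NumberTheory.Automorphic.UnitaryLatticeTree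

end
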